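import Literature.AlgebraicGeometry.Frobenioids.Thm49OfPreSteps
import Literature.AlgebraicGeometry.Frobenioids.Thm49CompatOfPreSteps
import Literature.AlgebraicGeometry.Frobenioids.EquivalencePreStepsFSMFF2008Assembly
import Literature.AlgebraicGeometry.Frobenioids.Prop55Sub
import HarnessLib

/-!
# Frobenioids I, Theorem 4.9 (with its compatibility clause) AS PRINTED — for every pair of Frobenioids,
# with NO base-type hypothesis beyond print's own antecedents

Mochizuki, *The geometry of Frobenioids I: the general theory*, Kyushu J. Math. **62** (2008) 293–400,
§4, Theorem 4.9 (Category-theoreticity of divisor monoids), statement p. 88 l. 36 – p. 89 l. 2, proof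
p. 89 ll. 3–41 [cite: MochizukiFrdI2008, Thm. 4.9 p.88]: for Frobenioids `C_i → F_{Φ_i}` of rationally standard
type and an equivalence `Ψ : C₁ ⥲ C₂` there exists an isomorphism of functors `Ψ^Φ : Φ₁ ⥲ Φ₂` lying over `Ψ`,
compatible — when the `C_i` are of isotropic but not group-like type — with the bijection of primes `Ψ^Prime` of
Thm. 4.2 (ii).

PROOF-ONLY file (abc-iut cell, block F fact-proving wave, seat abc-iut-f-027 floating on tranche 34, FACT-LIST
rows F-1032 `PreFrobenioidData.Thm49` and F-1033 `PreFrobenioidData.Thm49_compat` — PARAMETRISED schemas over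
the bare operations interface `PreFrobenioidData`, the data-only `RSParams`, resp. a free pair `(E, e)`; per the
cell's rule R1 the deliverable is the INSTANCE FORM the cone consumes, i.e. the schema at
`PreFrobenioidData.ofFunctor Φ_i F_i`; for `Thm49_compat` the meaningful instance is the EXISTENCE of a pair
`(Ψ^Φ, Ψ^Prime)` satisfying it). 0 definitions.

What is new. The `C`-level closers of seats abc-iut-w4-d105 / w4-d109 / w4-d099
(`FrdI.T49.thm49_ofFunctor_of_preservesPreSteps`, `Thm49OfPreSteps.lean`;
`FrdI.T49.exists_thm49_compat_ofFunctor_of_preservesPreSteps`, `Thm49CompatOfPreSteps.lean`) hold the typed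
Thm. 4.9 and its compatibility clause for all Frobenioids MODULO ONLY the pre-step clause of Thm. 3.4 (ii)
"`Ψ`, `Ψ⁻¹` preserve pre-steps", which the tree had over bases of FSM-type / FSMFF-type in the 2024 sense.
Since `EquivalencePreStepsFSMFF2008Assembly.lean` (abc-iut-L1-t11 over abc-iut-L1-t13's core) that clause is a
THEOREM over bases of FSMFF-type in the PRINTED 2008 sense
(`FrdI.isPreStep_map_of_quasiIsotropic_of_isOfFSMFFType`, hypothesis on the TARGET base only) — and
"`D_i` of FSMFF-type" is hypothesis (d) of "standard type" (Def. 3.1 (i) p. 56), part of "rationally standard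
type" (Def. 4.5 (iii)), i.e. of Thm. 4.9's OWN antecedent. Hence:

* `FrdI.T49.thm49_ofFunctor` — the typed `PreFrobenioidData.Thm49` at `ofFunctor`, for EVERY pair of
  Frobenioids with perf-factorial `Φ_i` (the standing hypothesis of Thm. 4.2, through which the proof runs) and
  `C₁` of rational type at THE birationalization / primary support, every `Ψ`, all parameters `R_i` — NO
  base-type hypothesis; `FrdI.T49.thm49_ofFunctor_primarySupp` — the same with the rationality input READ OFF
  the antecedent "`C₁` of rationally standard type" when `R₁` carries THE birationalization and the primary
  support (only `Φ_i` perf-factorial remains as an input); `FrdI.T49.thm49_rsParams` — the same at the NAMED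
  parameters `PreFrobenioid.rsParams hF₁ PrimarySupp` (v2, additive);
* `FrdI.T49.exists_thm49_compat_ofFunctor` — under `Thm42Setting` (standard + isotropic + non-group-like, the
  clause's own scope) there EXIST `Ψ^Φ` over `Ψ` with the divisor clause on pre-steps and THE `Ψ^Prime` of
  Thm. 4.2 (ii) satisfying the typed `PreFrobenioidData.Thm49_compat` — NO base-type hypothesis;
  `FrdI.T49.exists_divisorMonoidIsoOver_thm49_compat_forall_ofFunctor` — compatibility with EVERY
  prime-correspondence satisfying clause (a) of Thm. 4.2 (ii).

No statement of the paper is restated or strengthened; no new definition; nothing here bears on the disputed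
[IUTchIII] Cor. 3.12 (no side taken).
-/

-- As in the Thm. 3.4 lineage files (`EquivalencePreStepsFSMFF2008Assembly.lean`).
set_option backward.isDefEq.respectTransparency false

namespace Literature.AlgebraicGeometry.Frobenioids

namespace FrdI.T49

open CategoryTheory Opposite PreFrobenioidData

universe w v v' u u'

variable {D₁ : Type u} [Category.{v} D₁] {Φ₁ : D₁ᵒᵖ ⥤ CommMonCat.{w}} {C₁ : Type u'} [Category.{v'} C₁]
  {D₂ : Type u} [Category.{v} D₂] {Φ₂ : D₂ᵒᵖ ⥤ CommMonCat.{w}} {C₂ : Type u'} [Category.{v'} C₂]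
  {F₁ : C₁ ⥤ ElemFrobenioid Φ₁} {F₂ : C₂ ⥤ ElemFrobenioid Φ₂}

/-! ### Theorem 4.9 itself (the typed `Thm49` at `ofFunctor`) -/

/-- **[FrdI] Theorem 4.9 AS TYPED (`PreFrobenioidData.Thm49` at `ofFunctor`), for EVERY pair of Frobenioids —
no base-type hypothesis** — with perf-factorial `Φ_i` and `C₁` of rational type at THE birationalization /
primary support: for `C_i` of rationally standard type there is an isomorphism of functors `Ψ^Φ : Φ₁ ⥲ Φ₂`
lying over `Ψ`. Proof = abc-iut-w4-d105's `thm49_ofFunctor_of_preservesPreSteps` (print p. 89: group-like case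
trivial; isotropifications, Thm. 3.4 (iii) for `Ψ^istr` from pre-step preservation, perfections, Rmk. 4.5.1 +
Prop. 5.5 (iii) rationality, the perfect core, descents) with "`Ψ`, `Ψ⁻¹` preserve pre-steps" supplied by
Thm. 3.4 (ii) AS PRINTED (`FrdI.isPreStep_map_of_quasiIsotropic_of_isOfFSMFFType`), whose hypotheses
"quasi-isotropic" and "`D_i` of FSMFF-type" are clauses of the antecedent "rationally standard type".
[cite: MochizukiFrdI2008, Thm. 4.9 p.88] -/
theorem thm49_ofFunctor (hF₁ : PreFrobenioid.IsFrobenioid F₁) (hF₂ : PreFrobenioid.IsFrobenioid F₂)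
    (hpf₁ : Objectwise (fun M _ => IsPerfFactorial M) Φ₁) (hpf₂ : Objectwise (fun M _ => IsPerfFactorial M) Φ₂)
    (hrat₁ : ∀ A : C₁, PreFrobenioidData.IsRational
      (PreFrobenioid.biratData hF₁ (PreFrobenioid.hasBiratSquares_of_isFrobenioid hF₁))
      (S := ofFunctor Φ₁ F₁) (fun a 𝔭 => PrimarySupp a 𝔭) A)
    (Ψ : C₁ ≌ C₂) (R₁ : (ofFunctor Φ₁ F₁).RSParams) (R₂ : (ofFunctor Φ₂ F₂).RSParams) :
    (ofFunctor Φ₁ F₁).Thm49 (ofFunctor Φ₂ F₂) Ψ R₁ R₂ := by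
  intro hR₁ hR₂
  have hs₁ := hR₁.standard
  have hs₂ := hR₂.standard
  exact thm49_ofFunctor_of_preservesPreSteps hF₁ hF₂ hpf₁ hpf₂ hrat₁ Ψ
    (fun _ _ _ h => FrdI.isPreStep_map_of_quasiIsotropic_of_isOfFSMFFType hF₁ hF₂ hs₁.quasiIsotropic
      hs₂.quasiIsotropic hs₂.fsmff Ψ h)
    (fun _ _ _ h => FrdI.isPreStep_map_of_quasiIsotropic_of_isOfFSMFFType hF₂ hF₁ hs₂.quasiIsotropic
      hs₁.quasiIsotropic hs₁.fsmff Ψ.symm h)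
    R₁ R₂ hR₁ hR₂

/-- **[FrdI] Theorem 4.9 AS TYPED at `ofFunctor`, the rationality input read off the antecedent**: when the
parameter `R₁` carries THE birationalization `C₁^birat` (Prop. 4.4, at the square-completions of Prop. 1.11 (vii))
and the primary support of Def. 2.4 (i)(d) — the data at which the tree's producers establish "rational type" —
clause (a) "rational type" of "`C₁` of rationally standard type" IS the rationality input of `thm49_ofFunctor`, so
the typed Thm. 4.9 holds for every pair of Frobenioids with perf-factorial `Φ_i`, every `Ψ`, every `R₂` and every
choice of the remaining (`C^un-tr`-) components of `R₁`. [cite: MochizukiFrdI2008, Thm. 4.9 p.88] -/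
theorem thm49_ofFunctor_primarySupp (hF₁ : PreFrobenioid.IsFrobenioid F₁) (hF₂ : PreFrobenioid.IsFrobenioid F₂)
    (hpf₁ : Objectwise (fun M _ => IsPerfFactorial M) Φ₁) (hpf₂ : Objectwise (fun M _ => IsPerfFactorial M) Φ₂)
    (Ψ : C₁ ≌ C₂) (SU₁ : PreFrobenioidData.{w} (ofFunctor Φ₁ F₁).Untr D₁) (BU₁ : SU₁.BiratData)
    (R₂ : (ofFunctor Φ₂ F₂).RSParams) :
    (ofFunctor Φ₁ F₁).Thm49 (ofFunctor Φ₂ F₂) Ψ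
      ⟨PreFrobenioid.biratData hF₁ (PreFrobenioid.hasBiratSquares_of_isFrobenioid hF₁),
        fun a 𝔭 => PrimarySupp a 𝔭, SU₁, BU₁⟩ R₂ :=
  fun hR₁ hR₂ => thm49_ofFunctor hF₁ hF₂ hpf₁ hpf₂ (fun A => hR₁.rational A) Ψ _ R₂ hR₁ hR₂

/-! ### Theorem 4.9 with its compatibility clause (the typed `Thm49_compat` at `ofFunctor`): existence -/

/-- **[FrdI] Theorem 4.9 WITH its compatibility clause, AT THE `C`-LEVEL, for EVERY pair of Frobenioids in the
clause's own scope — no base-type hypothesis**: under `Thm42Setting` (standard type; isotropic, non-group-like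
types), `Φ_i` perf-factorial, `C₁` of rational type at THE constructions, there exist THE `Ψ^Prime` of
Thm. 4.2 (ii) (clauses (a), (b)) and a `Ψ^Φ : Φ₁ ⥲ Φ₂` over `Ψ` with the divisor clause on pre-steps,
satisfying the typed `PreFrobenioidData.Thm49_compat` (print p. 89 ll. 1–2, "from the construction"
ll. 12–33). Route = abc-iut-w4-d099/w4-d105's `exists_thm49_compat_ofFunctor_of_preservesPreSteps` with the
pre-step clause of Thm. 3.4 (ii) AS PRINTED (`FrdI.isPreStep_map_of_quasiIsotropic_of_isOfFSMFFType`; its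
FSMFF hypothesis is (d) of standard type). [cite: MochizukiFrdI2008, Thm. 4.9 p.89] -/
theorem exists_thm49_compat_ofFunctor (hF₁ : PreFrobenioid.IsFrobenioid F₁)
    (hF₂ : PreFrobenioid.IsFrobenioid F₂)
    (hpf₁ : Objectwise (fun M _ => IsPerfFactorial M) Φ₁) (hpf₂ : Objectwise (fun M _ => IsPerfFactorial M) Φ₂)
    (hrat₁ : ∀ A : C₁, PreFrobenioidData.IsRational
      (PreFrobenioid.biratData hF₁ (PreFrobenioid.hasBiratSquares_of_isFrobenioid hF₁))
      (S := ofFunctor Φ₁ F₁) (fun a 𝔭 => PrimarySupp a 𝔭) A)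
    (Ψ : C₁ ≌ C₂) (hT : Thm42Setting (ofFunctor Φ₁ F₁) (ofFunctor Φ₂ F₂)) :
    ∃ (E : DivisorMonoidIsoOver (ofFunctor Φ₁ F₁) (ofFunctor Φ₂ F₂) Ψ)
      (e : ∀ A : C₁, Primes (Φ₁.obj (op (PreFrobenioid.baseObj F₁ A))) ≃
        Primes (Φ₂.obj (op (PreFrobenioid.baseObj F₂ (Ψ.functor.obj A))))),
      (∀ (A : C₁) (𝔭 : Primes (Φ₁.obj (op (PreFrobenioid.baseObj F₁ A)))),
        (∀ ⦃B : C₁⦄ (φ : A ⟶ B), PreFrobenioid.IsCoAngularPreStep F₁ φ →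
            (PreFrobenioid.Div F₁ φ ∈ 𝔭.submonoid ↔
              PreFrobenioid.Div F₂ (Ψ.functor.map φ) ∈ (e A 𝔭).submonoid)) ∧
        ∀ ⦃B : C₁⦄ (ψ : B ⟶ A), PreFrobenioid.IsCoAngularPreStep F₁ ψ →
          ((∃ y ∈ 𝔭.submonoid, pull Φ₁ (PreFrobenioid.Base F₁ ψ) y = PreFrobenioid.Div F₁ ψ) ↔
            ∃ y ∈ (e A 𝔭).submonoid, pull Φ₂ (PreFrobenioid.Base F₂ (Ψ.functor.map ψ)) y =
              PreFrobenioid.Div F₂ (Ψ.functor.map ψ))) ∧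
      (∀ ⦃A B : C₁⦄ (φ : A ⟶ B), PreFrobenioid.IsPreStep F₁ φ →
          E.iso A (PreFrobenioid.Div F₁ φ) = PreFrobenioid.Div F₂ (Ψ.functor.map φ)) ∧
      Literature.AlgebraicGeometry.Frobenioids.PreFrobenioidData.Thm49_compat
        (ofFunctor Φ₁ F₁) (ofFunctor Φ₂ F₂) Ψ E e :=
  exists_thm49_compat_ofFunctor_of_preservesPreSteps hF₁ hF₂ hpf₁ hpf₂ hrat₁ Ψ hT
    (fun _ _ _ h => FrdI.isPreStep_map_of_quasiIsotropic_of_isOfFSMFFType hF₁ hF₂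
      hT.standard.1.quasiIsotropic hT.standard.2.quasiIsotropic hT.standard.2.fsmff Ψ h)
    (fun _ _ _ h => FrdI.isPreStep_map_of_quasiIsotropic_of_isOfFSMFFType hF₂ hF₁
      hT.standard.2.quasiIsotropic hT.standard.1.quasiIsotropic hT.standard.1.fsmff Ψ.symm h)

/-- **Compatibility with EVERY prime-correspondence satisfying clause (a) of Thm. 4.2 (ii), for every pair of
Frobenioids in the clause's scope — no base-type hypothesis** (p. 89 ll. 1–2 with ll. 12–33 "from the
construction"): there is a `Ψ^Φ` over `Ψ` with the divisor clause on pre-steps which satisfies the typed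
`Thm49_compat` against any family of bijections of primes `e` compatible with the divisors of co-angular
pre-steps. [cite: MochizukiFrdI2008, Thm. 4.9 p.89] -/
theorem exists_divisorMonoidIsoOver_thm49_compat_forall_ofFunctor (hF₁ : PreFrobenioid.IsFrobenioid F₁)
    (hF₂ : PreFrobenioid.IsFrobenioid F₂)
    (hpf₁ : Objectwise (fun M _ => IsPerfFactorial M) Φ₁) (hpf₂ : Objectwise (fun M _ => IsPerfFactorial M) Φ₂)
    (hrat₁ : ∀ A : C₁, PreFrobenioidData.IsRational
      (PreFrobenioid.biratData hF₁ (PreFrobenioid.hasBiratSquares_of_isFrobenioid hF₁))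
      (S := ofFunctor Φ₁ F₁) (fun a 𝔭 => PrimarySupp a 𝔭) A)
    (Ψ : C₁ ≌ C₂) (hT : Thm42Setting (ofFunctor Φ₁ F₁) (ofFunctor Φ₂ F₂)) :
    ∃ E : DivisorMonoidIsoOver (ofFunctor Φ₁ F₁) (ofFunctor Φ₂ F₂) Ψ,
      (∀ ⦃A B : C₁⦄ (φ : A ⟶ B), PreFrobenioid.IsPreStep F₁ φ →
          E.iso A (PreFrobenioid.Div F₁ φ) = PreFrobenioid.Div F₂ (Ψ.functor.map φ)) ∧
      ∀ (e : ∀ A : C₁, Primes (Φ₁.obj (op (PreFrobenioid.baseObj F₁ A))) ≃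
          Primes (Φ₂.obj (op (PreFrobenioid.baseObj F₂ (Ψ.functor.obj A))))),
        (∀ (A : C₁) (𝔭 : Primes (Φ₁.obj (op (PreFrobenioid.baseObj F₁ A)))) ⦃B : C₁⦄ (φ : A ⟶ B),
          PreFrobenioid.IsCoAngularPreStep F₁ φ →
            (PreFrobenioid.Div F₁ φ ∈ 𝔭.submonoid ↔
              PreFrobenioid.Div F₂ (Ψ.functor.map φ) ∈ (e A 𝔭).submonoid)) →
        Literature.AlgebraicGeometry.Frobenioids.PreFrobenioidData.Thm49_compat
          (ofFunctor Φ₁ F₁) (ofFunctor Φ₂ F₂) Ψ E e :=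
  exists_divisorMonoidIsoOver_thm49_compat_forall_of_preservesPreSteps hF₁ hF₂ hpf₁ hpf₂ hrat₁ Ψ hT
    (fun _ _ _ h => FrdI.isPreStep_map_of_quasiIsotropic_of_isOfFSMFFType hF₁ hF₂
      hT.standard.1.quasiIsotropic hT.standard.2.quasiIsotropic hT.standard.2.fsmff Ψ h)
    (fun _ _ _ h => FrdI.isPreStep_map_of_quasiIsotropic_of_isOfFSMFFType hF₂ hF₁
      hT.standard.2.quasiIsotropic hT.standard.1.quasiIsotropic hT.standard.1.fsmff Ψ.symm h)

/-! ### At the NAMED parameters `PreFrobenioid.rsParams` (v2, additive) -/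

/-- **[FrdI] Theorem 4.9 AS TYPED at the NAMED parameters `PreFrobenioid.rsParams hF₁ PrimarySupp`** — THE
Def. 4.5 (iii) data `(C₁^birat, Supp, C₁^un-tr, (C₁^un-tr)^birat)` (abc-iut-L6-t6 / L1-t5 lineage, `Prop55Sub.lean`)
with the primary support of Def. 2.4 (i)(d), the vocabulary in which the tree's producers of "rationally standard
type" are stated — for EVERY pair of Frobenioids with perf-factorial `Φ_i`, every `Ψ`, every `R₂`; no base-type
hypothesis, no rationality input (it is clause (a) of the antecedent). Definitionally `thm49_ofFunctor_primarySupp`.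
[cite: MochizukiFrdI2008, Thm. 4.9 p.88] -/
theorem thm49_rsParams (hF₁ : PreFrobenioid.IsFrobenioid F₁) (hF₂ : PreFrobenioid.IsFrobenioid F₂)
    (hpf₁ : Objectwise (fun M _ => IsPerfFactorial M) Φ₁) (hpf₂ : Objectwise (fun M _ => IsPerfFactorial M) Φ₂)
    (Ψ : C₁ ≌ C₂) (R₂ : (ofFunctor Φ₂ F₂).RSParams) :
    (ofFunctor Φ₁ F₁).Thm49 (ofFunctor Φ₂ F₂) Ψ (PreFrobenioid.rsParams hF₁ fun a 𝔭 => PrimarySupp a 𝔭) R₂ :=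
  thm49_ofFunctor_primarySupp hF₁ hF₂ hpf₁ hpf₂ Ψ _ _ R₂

end FrdI.T49

end Literature.AlgebraicGeometry.Frobenioids
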